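import Mathlib
import Summits.Ventures.PercRepro2.Defs
import Summits.Ventures.PercRepro2.CoinTraceBlock
import Summits.Ventures.PercRepro2.CoinTraceShift

/-!
# The four SIGN BLOCKS of the pendant method, for an arbitrary pendant set (blind cell
PercRepro2, night-2 g3; proofs/NIGHT2-DARC.md §19)

For a trace law `μ` on `P.powerset` (`w ∈ P`) with data `x, y` (decreasing, `≤ 1`) and pivotal
data `x̂, ŷ` (decreasing, `≤ x`, `= x` off `{Z ∋ w}`), centred at `Λ = Σ μ`, `MX = Σ x μ`:
* `avoid_block_nonneg` — (a): the block of `𝒩_w = {Z ∌ w}`;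
* `top_block_nonneg` — (c): the block of `𝒩_w ∪ {P}`;
* `cylinder_block_nonneg` — (15.8): the block of `𝒩_w ∪ {Z ∋ v}` for a vertex `v` with (CU-PA);
* `all_block_nonneg` — (b): the block of the whole family with the pivotal data.
All four are `block_nonneg` with the shifts of `CoinTraceShift.lean`; an Abel decomposition of
the pivotal weight into nonnegative combinations of these families proves `S′ ≥ 0` for a head.
-/

namespace Summit.Ventures.PercRepro2.Coin

section Blocks

open Classical

variable {V : Type*} [DecidableEq V] {R : Type*} [Field R] [LinearOrder R] [IsStrictOrderedRing R]

/-- Block (a): the non-pivotal family `𝒩_w`. -/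
theorem avoid_block_nonneg (P : Finset V) {w : V} (hwP : w ∈ P) (μ x y xh yh : Finset V → R)
    (hμ : ∀ Z ∈ P.powerset, 0 ≤ μ Z)
    (hx1 : ∀ Z : Finset V, Z ⊆ P → x Z ≤ 1) (hy1 : ∀ Z : Finset V, Z ⊆ P → y Z ≤ 1)
    (hxh1 : ∀ Z : Finset V, Z ⊆ P → xh Z ≤ 1) (hyh1 : ∀ Z : Finset V, Z ⊆ P → yh Z ≤ 1)
    (hxanti : ∀ Z Z' : Finset V, Z ⊆ Z' → Z' ⊆ P → x Z' ≤ x Z)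
    (hyanti : ∀ Z Z' : Finset V, Z ⊆ Z' → Z' ⊆ P → y Z' ≤ y Z)
    (hxhanti : ∀ Z Z' : Finset V, Z ⊆ Z' → Z' ⊆ P → xh Z' ≤ xh Z)
    (hyhanti : ∀ Z Z' : Finset V, Z ⊆ Z' → Z' ⊆ P → yh Z' ≤ yh Z)
    (hxh_eq : ∀ Z : Finset V, Z ⊆ P → w ∉ Z → xh Z = x Z)
    (hyh_eq : ∀ Z : Finset V, Z ⊆ P → w ∉ Z → yh Z = y Z) (hPA : TracePA P μ) :
    0 ≤ ∑ Z ∈ P.powerset.filter (fun Z => Disjoint Z {w}),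
      μ Z * (xh Z * (∑ Z' ∈ P.powerset, μ Z') - ∑ Z' ∈ P.powerset, x Z' * μ Z') *
        (yh Z * (∑ Z' ∈ P.powerset, μ Z') - ∑ Z' ∈ P.powerset, y Z' * μ Z') := by
  refine block_nonneg _ μ xh yh _ _ _ (fun Z hZ => hμ Z (Finset.mem_filter.mp hZ).1) ?_
    (Or.inl ⟨?_, ?_⟩)
  · exact hPA {w} (Finset.singleton_subset_iff.mpr hwP) (fun Z => 1 - xh Z) (fun Z => 1 - yh Z)
      (fun Z Z' h h' => by show 1 - xh Z ≤ 1 - xh Z'; linarith [hxhanti Z Z' h h'])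
      (fun Z Z' h h' => by show 1 - yh Z ≤ 1 - yh Z'; linarith [hyhanti Z Z' h h'])
      (fun Z h => by show 0 ≤ 1 - xh Z; linarith [hxh1 Z h])
      (fun Z h => by show 0 ≤ 1 - yh Z; linarith [hyh1 Z h])
  · have h := shift_avoid_of_tracePA P μ x hPA hx1 hxanti {w}
    have e : ∑ Z ∈ P.powerset.filter (fun Z => Disjoint Z {w}), xh Z * μ Z =
        ∑ Z ∈ P.powerset.filter (fun Z => Disjoint Z {w}), x Z * μ Z :=
      Finset.sum_congr rfl fun Z hZ => by
        rw [hxh_eq Z (Finset.mem_powerset.mp (Finset.mem_filter.mp hZ).1)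
          (Finset.disjoint_singleton_right.mp (Finset.mem_filter.mp hZ).2)]
    rw [e]; exact h
  · have h := shift_avoid_of_tracePA P μ y hPA hy1 hyanti {w}
    have e : ∑ Z ∈ P.powerset.filter (fun Z => Disjoint Z {w}), yh Z * μ Z =
        ∑ Z ∈ P.powerset.filter (fun Z => Disjoint Z {w}), y Z * μ Z :=
      Finset.sum_congr rfl fun Z hZ => by
        rw [hyh_eq Z (Finset.mem_powerset.mp (Finset.mem_filter.mp hZ).1)
          (Finset.disjoint_singleton_right.mp (Finset.mem_filter.mp hZ).2)]
    rw [e]; exact h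

/-- Block (c): the family `𝒩_w ∪ {P}`. -/
theorem top_block_nonneg (P : Finset V) {w : V} (hwP : w ∈ P) (μ x y xh yh : Finset V → R)
    (hμ : ∀ Z ∈ P.powerset, 0 ≤ μ Z)
    (hx1 : ∀ Z : Finset V, Z ⊆ P → x Z ≤ 1) (hy1 : ∀ Z : Finset V, Z ⊆ P → y Z ≤ 1)
    (hxh1 : ∀ Z : Finset V, Z ⊆ P → xh Z ≤ 1) (hyh1 : ∀ Z : Finset V, Z ⊆ P → yh Z ≤ 1)
    (hxanti : ∀ Z Z' : Finset V, Z ⊆ Z' → Z' ⊆ P → x Z' ≤ x Z)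
    (hyanti : ∀ Z Z' : Finset V, Z ⊆ Z' → Z' ⊆ P → y Z' ≤ y Z)
    (hxhanti : ∀ Z Z' : Finset V, Z ⊆ Z' → Z' ⊆ P → xh Z' ≤ xh Z)
    (hyhanti : ∀ Z Z' : Finset V, Z ⊆ Z' → Z' ⊆ P → yh Z' ≤ yh Z)
    (hxh_le : ∀ Z : Finset V, Z ⊆ P → xh Z ≤ x Z) (hyh_le : ∀ Z : Finset V, Z ⊆ P → yh Z ≤ y Z)
    (hxh_eq : ∀ Z : Finset V, Z ⊆ P → w ∉ Z → xh Z = x Z)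
    (hyh_eq : ∀ Z : Finset V, Z ⊆ P → w ∉ Z → yh Z = y Z) (hPA : TracePA P μ) :
    0 ≤ ∑ Z ∈ P.powerset.filter (fun Z => Disjoint Z {w} ∨ Z = P),
      μ Z * (xh Z * (∑ Z' ∈ P.powerset, μ Z') - ∑ Z' ∈ P.powerset, x Z' * μ Z') *
        (yh Z * (∑ Z' ∈ P.powerset, μ Z') - ∑ Z' ∈ P.powerset, y Z' * μ Z') := by
  have hA := avoid_block_nonneg P hwP μ x y xh yh hμ hx1 hy1 hxh1 hyh1 hxanti hyanti hxhanti
    hyhanti hxh_eq hyh_eq hPA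
  have hΛn : 0 ≤ ∑ Z' ∈ P.powerset, μ Z' := Finset.sum_nonneg hμ
  have hxtop : xh P * (∑ Z' ∈ P.powerset, μ Z') - ∑ Z' ∈ P.powerset, x Z' * μ Z' ≤ 0 := by
    have h1 : x P * (∑ Z' ∈ P.powerset, μ Z') ≤ ∑ Z' ∈ P.powerset, x Z' * μ Z' := by
      rw [Finset.mul_sum]
      exact Finset.sum_le_sum fun Z hZ => mul_le_mul_of_nonneg_right
        (hxanti Z P (Finset.mem_powerset.mp hZ) (subset_refl _)) (hμ Z hZ)
    have h2 : xh P * (∑ Z' ∈ P.powerset, μ Z') ≤ x P * (∑ Z' ∈ P.powerset, μ Z') :=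
      mul_le_mul_of_nonneg_right (hxh_le P (subset_refl _)) hΛn
    linarith
  have hytop : yh P * (∑ Z' ∈ P.powerset, μ Z') - ∑ Z' ∈ P.powerset, y Z' * μ Z' ≤ 0 := by
    have h1 : y P * (∑ Z' ∈ P.powerset, μ Z') ≤ ∑ Z' ∈ P.powerset, y Z' * μ Z' := by
      rw [Finset.mul_sum]
      exact Finset.sum_le_sum fun Z hZ => mul_le_mul_of_nonneg_right
        (hyanti Z P (Finset.mem_powerset.mp hZ) (subset_refl _)) (hμ Z hZ)
    have h2 : yh P * (∑ Z' ∈ P.powerset, μ Z') ≤ y P * (∑ Z' ∈ P.powerset, μ Z') :=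
      mul_le_mul_of_nonneg_right (hyh_le P (subset_refl _)) hΛn
    linarith
  rw [← Finset.sum_filter_add_sum_filter_not _ (fun Z => Disjoint Z {w})]
  have e1 : (P.powerset.filter (fun Z => Disjoint Z {w} ∨ Z = P)).filter
      (fun Z => Disjoint Z {w}) = P.powerset.filter (fun Z => Disjoint Z {w}) := by
    rw [Finset.filter_filter]
    exact Finset.filter_congr fun Z _ => ⟨fun h => h.2, fun h => ⟨Or.inl h, h⟩⟩
  rw [e1]
  refine add_nonneg hA (Finset.sum_nonneg fun Z hZ => ?_)
  rw [Finset.mem_filter, Finset.mem_filter, Finset.mem_powerset] at hZ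
  obtain ⟨⟨_, hBZ⟩, hnA⟩ := hZ
  rcases hBZ with hA' | hZe
  · exact absurd hA' hnA
  · rw [hZe]
    exact mul_nonneg_of_nonpos_of_nonpos
      (mul_nonpos_of_nonneg_of_nonpos (hμ P (Finset.mem_powerset_self _)) hxtop) hytop

/-- Block (15.8): the family `𝒩_w ∪ {Z ∋ v}` for a vertex `v ∈ P` carrying (CU-PA). -/
theorem cylinder_block_nonneg (P : Finset V) {w v : V} (hwP : w ∈ P) (hvP : v ∈ P)
    (μ x y xh yh : Finset V → R) (hμ : ∀ Z ∈ P.powerset, 0 ≤ μ Z)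
    (hx1 : ∀ Z : Finset V, Z ⊆ P → x Z ≤ 1) (hy1 : ∀ Z : Finset V, Z ⊆ P → y Z ≤ 1)
    (hxh1 : ∀ Z : Finset V, Z ⊆ P → xh Z ≤ 1) (hyh1 : ∀ Z : Finset V, Z ⊆ P → yh Z ≤ 1)
    (hxanti : ∀ Z Z' : Finset V, Z ⊆ Z' → Z' ⊆ P → x Z' ≤ x Z)
    (hyanti : ∀ Z Z' : Finset V, Z ⊆ Z' → Z' ⊆ P → y Z' ≤ y Z)
    (hxhanti : ∀ Z Z' : Finset V, Z ⊆ Z' → Z' ⊆ P → xh Z' ≤ xh Z)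
    (hyhanti : ∀ Z Z' : Finset V, Z ⊆ Z' → Z' ⊆ P → yh Z' ≤ yh Z)
    (hxh_le : ∀ Z : Finset V, Z ⊆ P → xh Z ≤ x Z) (hyh_le : ∀ Z : Finset V, Z ⊆ P → yh Z ≤ y Z)
    (hxh_eq : ∀ Z : Finset V, Z ⊆ P → w ∉ Z → xh Z = x Z)
    (hyh_eq : ∀ Z : Finset V, Z ⊆ P → w ∉ Z → yh Z = y Z) (hPA : TracePA P μ)
    (hCU : TraceCUPA P μ v) :
    0 ≤ ∑ Z ∈ P.powerset.filter (fun Z => Disjoint Z {w} ∨ v ∈ Z),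
      μ Z * (xh Z * (∑ Z' ∈ P.powerset, μ Z') - ∑ Z' ∈ P.powerset, x Z' * μ Z') *
        (yh Z * (∑ Z' ∈ P.powerset, μ Z') - ∑ Z' ∈ P.powerset, y Z' * μ Z') := by
  have hΛn : 0 ≤ ∑ Z' ∈ P.powerset, μ Z' := Finset.sum_nonneg hμ
  have monX : ∀ Z Z' : Finset V, Z ⊆ Z' → Z' ⊆ P → (fun Z => 1 - xh Z) Z ≤ (fun Z => 1 - xh Z) Z' :=
    fun Z Z' h h' => by show 1 - xh Z ≤ 1 - xh Z'; linarith [hxhanti Z Z' h h']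
  have monY : ∀ Z Z' : Finset V, Z ⊆ Z' → Z' ⊆ P → (fun Z => 1 - yh Z) Z ≤ (fun Z => 1 - yh Z) Z' :=
    fun Z Z' h h' => by show 1 - yh Z ≤ 1 - yh Z'; linarith [hyhanti Z Z' h h']
  have nnX : ∀ Z : Finset V, Z ⊆ P → 0 ≤ (fun Z => 1 - xh Z) Z :=
    fun Z h => by show 0 ≤ 1 - xh Z; linarith [hxh1 Z h]
  have nnY : ∀ Z : Finset V, Z ⊆ P → 0 ≤ (fun Z => 1 - yh Z) Z :=
    fun Z h => by show 0 ≤ 1 - yh Z; linarith [hyh1 Z h]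
  rw [← Finset.sum_filter_add_sum_filter_not _ (fun Z => v ∈ Z)]
  have e1 : (P.powerset.filter (fun Z => Disjoint Z {w} ∨ v ∈ Z)).filter (fun Z => v ∈ Z) =
      P.powerset.filter (fun Z => v ∈ Z) := by
    rw [Finset.filter_filter]
    exact Finset.filter_congr fun Z _ => ⟨fun h => h.2, fun h => ⟨Or.inr h, h⟩⟩
  have e2 : (P.powerset.filter (fun Z => Disjoint Z {w} ∨ v ∈ Z)).filter (fun Z => ¬ v ∈ Z) =
      P.powerset.filter (fun Z => Disjoint Z {w, v}) := by
    rw [Finset.filter_filter]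
    refine Finset.filter_congr fun Z _ => ?_
    constructor
    · rintro ⟨h | h, hn⟩
      · exact Finset.disjoint_insert_right.mpr
          ⟨Finset.disjoint_singleton_right.mp h, Finset.disjoint_singleton_right.mpr hn⟩
      · exact absurd h hn
    · intro h
      obtain ⟨hw, hv⟩ := Finset.disjoint_insert_right.mp h
      exact ⟨Or.inl (Finset.disjoint_singleton_right.mpr hw),
        Finset.disjoint_singleton_right.mp hv⟩
  rw [e1, e2]
  refine add_nonneg ?_ ?_
  · refine block_nonneg _ μ xh yh _ _ _ (fun Z hZ => hμ Z (Finset.mem_filter.mp hZ).1) ?_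
      (Or.inr ⟨?_, ?_⟩)
    · exact hCU _ _ monX monY nnX nnY
    · have h1 := shift_mem_of_tracePA P μ x hPA hx1 hxanti v
      have h2 : ∑ Z ∈ P.powerset.filter (fun Z => v ∈ Z), xh Z * μ Z ≤
          ∑ Z ∈ P.powerset.filter (fun Z => v ∈ Z), x Z * μ Z :=
        Finset.sum_le_sum fun Z hZ => mul_le_mul_of_nonneg_right
          (hxh_le Z (Finset.mem_powerset.mp (Finset.mem_filter.mp hZ).1))
          (hμ Z (Finset.mem_filter.mp hZ).1)
      exact (mul_le_mul_of_nonneg_right h2 hΛn).trans h1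
    · have h1 := shift_mem_of_tracePA P μ y hPA hy1 hyanti v
      have h2 : ∑ Z ∈ P.powerset.filter (fun Z => v ∈ Z), yh Z * μ Z ≤
          ∑ Z ∈ P.powerset.filter (fun Z => v ∈ Z), y Z * μ Z :=
        Finset.sum_le_sum fun Z hZ => mul_le_mul_of_nonneg_right
          (hyh_le Z (Finset.mem_powerset.mp (Finset.mem_filter.mp hZ).1))
          (hμ Z (Finset.mem_filter.mp hZ).1)
      exact (mul_le_mul_of_nonneg_right h2 hΛn).trans h1
  · refine block_nonneg _ μ xh yh _ _ _ (fun Z hZ => hμ Z (Finset.mem_filter.mp hZ).1) ?_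
      (Or.inl ⟨?_, ?_⟩)
    · exact hPA {w, v} (Finset.insert_subset hwP (Finset.singleton_subset_iff.mpr hvP)) _ _
        monX monY nnX nnY
    · have h := shift_avoid_of_tracePA P μ x hPA hx1 hxanti {w, v}
      have e : ∑ Z ∈ P.powerset.filter (fun Z => Disjoint Z {w, v}), xh Z * μ Z =
          ∑ Z ∈ P.powerset.filter (fun Z => Disjoint Z {w, v}), x Z * μ Z :=
        Finset.sum_congr rfl fun Z hZ => by
          rw [hxh_eq Z (Finset.mem_powerset.mp (Finset.mem_filter.mp hZ).1)
            (Finset.disjoint_insert_right.mp (Finset.mem_filter.mp hZ).2).1]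
      rw [e]; exact h
    · have h := shift_avoid_of_tracePA P μ y hPA hy1 hyanti {w, v}
      have e : ∑ Z ∈ P.powerset.filter (fun Z => Disjoint Z {w, v}), yh Z * μ Z =
          ∑ Z ∈ P.powerset.filter (fun Z => Disjoint Z {w, v}), y Z * μ Z :=
        Finset.sum_congr rfl fun Z hZ => by
          rw [hyh_eq Z (Finset.mem_powerset.mp (Finset.mem_filter.mp hZ).1)
            (Finset.disjoint_insert_right.mp (Finset.mem_filter.mp hZ).2).1]
      rw [e]; exact h

/-- Block (b): the whole family with the pivotal data. -/
theorem all_block_nonneg (P : Finset V) (μ x y xh yh : Finset V → R)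
    (hμ : ∀ Z ∈ P.powerset, 0 ≤ μ Z)
    (hxh1 : ∀ Z : Finset V, Z ⊆ P → xh Z ≤ 1) (hyh1 : ∀ Z : Finset V, Z ⊆ P → yh Z ≤ 1)
    (hxhanti : ∀ Z Z' : Finset V, Z ⊆ Z' → Z' ⊆ P → xh Z' ≤ xh Z)
    (hyhanti : ∀ Z Z' : Finset V, Z ⊆ Z' → Z' ⊆ P → yh Z' ≤ yh Z)
    (hxh_le : ∀ Z : Finset V, Z ⊆ P → xh Z ≤ x Z) (hyh_le : ∀ Z : Finset V, Z ⊆ P → yh Z ≤ y Z)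
    (hPA : TracePA P μ) :
    0 ≤ ∑ Z ∈ P.powerset,
      μ Z * (xh Z * (∑ Z' ∈ P.powerset, μ Z') - ∑ Z' ∈ P.powerset, x Z' * μ Z') *
        (yh Z * (∑ Z' ∈ P.powerset, μ Z') - ∑ Z' ∈ P.powerset, y Z' * μ Z') := by
  have hΛn : 0 ≤ ∑ Z' ∈ P.powerset, μ Z' := Finset.sum_nonneg hμ
  refine block_nonneg _ μ xh yh _ _ _ hμ ?_ (Or.inr ⟨?_, ?_⟩)
  · have h := hPA ∅ (Finset.empty_subset _) (fun Z => 1 - xh Z) (fun Z => 1 - yh Z)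
      (fun Z Z' h h' => by show 1 - xh Z ≤ 1 - xh Z'; linarith [hxhanti Z Z' h h'])
      (fun Z Z' h h' => by show 1 - yh Z ≤ 1 - yh Z'; linarith [hyhanti Z Z' h h'])
      (fun Z h => by show 0 ≤ 1 - xh Z; linarith [hxh1 Z h])
      (fun Z h => by show 0 ≤ 1 - yh Z; linarith [hyh1 Z h])
    simpa only [filter_disjoint_empty] using h
  · have h2 : ∑ Z ∈ P.powerset, xh Z * μ Z ≤ ∑ Z' ∈ P.powerset, x Z' * μ Z' :=
      Finset.sum_le_sum fun Z hZ => mul_le_mul_of_nonneg_right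
        (hxh_le Z (Finset.mem_powerset.mp hZ)) (hμ Z hZ)
    exact mul_le_mul_of_nonneg_right h2 hΛn
  · have h2 : ∑ Z ∈ P.powerset, yh Z * μ Z ≤ ∑ Z' ∈ P.powerset, y Z' * μ Z' :=
      Finset.sum_le_sum fun Z hZ => mul_le_mul_of_nonneg_right
        (hyh_le Z (Finset.mem_powerset.mp hZ)) (hμ Z hZ)
    exact mul_le_mul_of_nonneg_right h2 hΛn

end Blocks

end Summit.Ventures.PercRepro2.Coin
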